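/-
Copyright (c) 2026 the pub-hodgecm-mathlib formalisation cell (harness21).  Prover seat hodgecm-mathlib-LH6-p01 (g8): P6b wave C,
row Dβ part (Dβ-def) (desk F0P6b-plan (g14)); boxes LA-ref2 (g7) ∕ F0P6-ref1 (g9), 2026-09-03.
-/
import Literature.AlgebraicGeometry.Modules.EquivariantStructureRestrict
import Mathlib.AlgebraicGeometry.Pullbacks
import Mathlib.CategoryTheory.Monoidal.Cartesian.Over
import Mathlib.CategoryTheory.Monoidal.Cartesian.Mod
import HarnessLib

/-!
# `G`-linearisations of sheaves of modules for the action of a group SCHEME (equivariant structures, scheme form)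

Topic `Literature/AlgebraicGeometry/Modules`; namespace `Literature.AlgebraicGeometry.Modules`.  DEFINITIONS WITH BODIES + THEOREMS (no named
fact, no instance, no notation, no `sorry`).  Cell `pub/hodgecm-mathlib` (D-0151), P6b wave C, row Dβ (desk F0P6b-plan (g14)): organ capital for the
banked socket §D `stub_L4B1uD_mumfordLambdaDescent` of `Cruxes/HLiu418/Lines/F0_P6b_MumfordDualFlat.lean` (lane `--supports stmt-HodgeConjecture-24832`);
count-neutral.  HC_CM is proved only modulo the printed citations (2 remaining named inputs hLiu418 = `stmt-HodgeConjecture-24832`, h413 =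
`stmt-HodgeConjecture-24833`) until rung 0 closes; nothing here is about HC.

THE PRINT.  [MumfordFogartyKirwan1994, Ch. 1 §3 Def. 1.6 (p. 30)]: «Let `L` be an invertible sheaf on `X`, `σ : G × X → X` an action.  A
`G`-linearization of `L` is an isomorphism `φ : σ^*L ⥲ p₂^*L` satisfying the cocycle condition `[p₂₃^*φ] ∘ [(1_G × σ)^*φ] = [(μ × 1_X)^*φ]` on
`G × G × X`.» ([SGA3I] Exp. I §4.7: `G`-`𝒪_S`-modules; §6 of the 2011 re-edition.)  ★ `Modules/EquivariantStructure` types this POINTWISE in `g` for an abstract group acting by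
automorphisms (`RelativeSpec.ActionOver`, right for CONSTANT group schemes); the descent of Mumford's bundle `Λ(L)` along the quotient by the FINITE
FLAT (non-étale) `K(L)` ([MumfordAV1970] §13 pp. 125–127, any characteristic) needs the group-SCHEME form, typed here over Mathlib's `MonObj`∕`ModObj` in
the cartesian-monoidal `Over S` (the ★ Q-row currency of `GroupSchemes/GroupSchemeActionProperFree`: action `γ[G, X] : G ⊗ X ⟶ X`).

## What is typed
* §0 the maps of Def. 1.6 on Mathlib's left-bracketed `(G ⊗ G) ⊗ X` — `μ[G] ▷ X` (= `μ × 1_X`), `actRight := (α_).hom ≫ G ◁ γ` (= `1_G × σ`), `proj₂₃ :=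
  (α_).hom ≫ snd G (G ⊗ X)`, the unit slice `unitSlice := (λ_ X).inv ≫ η ▷ X` — and their five identities (one `simp` each from Mathlib `ModObj.one_smul ∕
  mul_smul`, `whiskerLeft_snd`, `whiskerRight_snd`, `associator_hom_snd_snd`), with scheme-level (`.left`) forms;
* §1 `sectionPullbackIso (h : u ≫ a = 𝟙) E : u^* a^* E ≅ E` + naturality (the square comparison is ★ `RelativeSpec.squareIso`, reused by name); §1b
  `compThreeIso x y π H F : x^* y^* π^* F ≅ ρ^* F` and its COHERENCES (`compThreeIso_eq` = Mathlib `pseudofunctor_associativity` via ★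
  `RelativeSpec.ActionOver.pullbackComp_hom_congr_eq`; `squareIso_pullback_obj_eq` ∕ `mapIso_squareIso_eq` ∕ `sectionPullbackIso_pullback_obj_eq`: every
  comparison at∕of a module pulled back from the base is `compThreeIso ≪≫ compThreeIso⁻¹`; `pullbackCongr` bookkeeping);
* §2 **`structure Linearisation G X E`** — DATA `iso : σ^* E ≅ p₂^* E` + `Prop`s `iso_unit`, `iso_mul` (equations between NAMED isomorphisms of fixed
  type); `iso_unit_hom` ∕ `iso_mul_hom`; §3 `Linearisation.ofIso` and **`Linearisation.ofPullback F`** — the canonical linearisation of `X.hom^* F`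
  (NON-VACUITY; the descent datum of every module coming from `S`), PROVED by telescoping §1b;
* §4 `restrictIso` — restriction of a structure isomorphism along a `G`-morphism `f : Y ⟶ X` (Mathlib `IsModHom G f`), iso-level plumbing for the
  NORMALISATION sentences of the consumers ([MumfordAV1970] §13: `Λ(L)|_{{0} × X}` trivial).
Not here: the dictionary with fppf descent data along a torsor quotient; tensor products; that `restrictIso` preserves the axioms; «constant group
scheme ⇒ ★ `EquivariantStructure`» (no `GrpObj` on `∐_g S` in the tree — fibrewise in `g` the cocycle IS ★ `EquivariantStructure.iso_mul`).

## References
* [MumfordFogartyKirwan1994] D. Mumford, J. Fogarty, F. Kirwan, *Geometric Invariant Theory*, 3rd ed. (1994), Ch. 1 §3 Def. 1.6 (p. 30).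
* [SGA3I] M. Demazure, A. Grothendieck (eds.), *SGA 3, Tome I* (LNM 151, 1970), Exp. I §4.7 (la catégorie des `G`-`𝒪_S`-modules); §6 Déf. 6.1 ∕ 6.5.1 of the 2011 re-edition.
* [MumfordAV1970] D. Mumford, *Abelian Varieties* (1970), §13, proof of the Theorem (pp. 125–127); §12 Thm. 1 (p. 111).
-/

set_option autoImplicit false

noncomputable section

-- `TopCat.Presheaf`/`Scheme.Modules` are not reducible (as in Mathlib's `AlgebraicGeometry/Modules/Sheaf.lean` and ★ `EquivariantStructureRestrict`).
set_option backward.isDefEq.respectTransparency false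

universe u

open CategoryTheory CategoryTheory.Limits AlgebraicGeometry MonoidalCategory CartesianMonoidalCategory
open scoped MonObj

namespace Literature.AlgebraicGeometry.Modules

/-! ## §0 The maps of [MumfordFogartyKirwan1994] Def. 1.6 on `G ×_S X` and `G ×_S G ×_S X`, and their identities -/

section Maps

variable {S : Scheme.{u}} (G X : Over S) [MonObj G] [σ : ModObj G X]

/-- The UNIT SLICE `x ↦ (1, x) : X → G ×_S X`. [cite: MumfordFogartyKirwan1994, Ch. 1 §3 Def. 1.6 (p. 30)] -/
def unitSlice : X ⟶ G ⊗ X :=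
  (λ_ X).inv ≫ η[G] ▷ X

/-- `1_G × σ : ((g₁, g₂), x) ↦ (g₁, g₂ · x)` on Mathlib's left-bracketed `(G ⊗ G) ⊗ X`. [cite: MumfordFogartyKirwan1994, Ch. 1 §3 Def. 1.6 (p. 30)] -/
def actRight : (G ⊗ G) ⊗ X ⟶ G ⊗ X :=
  (α_ G G X).hom ≫ G ◁ γ[G, X]

/-- `p₂₃ : ((g₁, g₂), x) ↦ (g₂, x)`. [cite: MumfordFogartyKirwan1994, Ch. 1 §3 Def. 1.6 (p. 30)] -/
def proj₂₃ : (G ⊗ G) ⊗ X ⟶ G ⊗ X :=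
  (α_ G G X).hom ≫ snd G (G ⊗ X)

/-- `(1, x) ↦ 1 · x = x` (Mathlib `ModObj.one_smul`). [cite: MumfordFogartyKirwan1994, Ch. 1 §3 Def. 1.6 (p. 30)] -/
@[reassoc]
theorem unitSlice_act : unitSlice G X ≫ γ[G, X] = 𝟙 X := by
  simp [unitSlice]

omit σ in
/-- `(1, x) ↦ x` along `p₂`. [cite: MumfordFogartyKirwan1994, Ch. 1 §3 Def. 1.6 (p. 30)] -/
@[reassoc]
theorem unitSlice_snd : unitSlice G X ≫ snd G X = 𝟙 X := by
  simp [unitSlice]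

/-- `σ ∘ (μ × 1_X) = σ ∘ (1_G × σ)` (Mathlib `ModObj.mul_smul`). [cite: MumfordFogartyKirwan1994, Ch. 1 §3 Def. 1.6 (p. 30)] -/
@[reassoc]
theorem mul_act : μ[G] ▷ X ≫ γ[G, X] = actRight G X ≫ γ[G, X] := by
  simp [actRight]

/-- `p₂ ∘ (1_G × σ) = σ ∘ p₂₃`. [cite: MumfordFogartyKirwan1994, Ch. 1 §3 Def. 1.6 (p. 30)] -/
@[reassoc]
theorem actRight_snd : actRight G X ≫ snd G X = proj₂₃ G X ≫ γ[G, X] := by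
  simp [actRight, proj₂₃]

omit σ in
/-- `p₂ ∘ p₂₃ = p₂ ∘ (μ × 1_X)` (both are the third projection). [cite: MumfordFogartyKirwan1994, Ch. 1 §3 Def. 1.6 (p. 30)] -/
@[reassoc]
theorem proj₂₃_snd : proj₂₃ G X ≫ snd G X = μ[G] ▷ X ≫ snd G X := by
  simp [proj₂₃]

/-- Scheme-level form of `unitSlice_act`. [cite: MumfordFogartyKirwan1994, Ch. 1 §3 Def. 1.6 (p. 30)] -/
theorem unitSlice_act_left : (unitSlice G X).left ≫ (γ[G, X]).left = 𝟙 X.left := by rw [← Over.comp_left, unitSlice_act]; rfl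

omit σ in
/-- Scheme-level form of `unitSlice_snd`. [cite: MumfordFogartyKirwan1994, Ch. 1 §3 Def. 1.6 (p. 30)] -/
theorem unitSlice_snd_left : (unitSlice G X).left ≫ (snd G X).left = 𝟙 X.left := by rw [← Over.comp_left, unitSlice_snd]; rfl

/-- Scheme-level form of `mul_act` (the `hsq` input of ★ `squareIso`). [cite: MumfordFogartyKirwan1994, Ch. 1 §3 Def. 1.6 (p. 30)] -/
theorem mul_act_left : (μ[G] ▷ X).left ≫ (γ[G, X]).left = (actRight G X).left ≫ (γ[G, X]).left := by
  rw [← Over.comp_left, ← Over.comp_left, mul_act]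

/-- Scheme-level form of `actRight_snd`. [cite: MumfordFogartyKirwan1994, Ch. 1 §3 Def. 1.6 (p. 30)] -/
theorem actRight_snd_left : (actRight G X).left ≫ (snd G X).left = (proj₂₃ G X).left ≫ (γ[G, X]).left := by
  rw [← Over.comp_left, ← Over.comp_left, actRight_snd]

omit σ in
/-- Scheme-level form of `proj₂₃_snd`. [cite: MumfordFogartyKirwan1994, Ch. 1 §3 Def. 1.6 (p. 30)] -/
theorem proj₂₃_snd_left : (proj₂₃ G X).left ≫ (snd G X).left = (μ[G] ▷ X).left ≫ (snd G X).left := by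
  rw [← Over.comp_left, ← Over.comp_left, proj₂₃_snd]

/-- Both legs of `G ×_S X ⇉ X` lie over `S`: `σ ≫ (X → S) = p₂ ≫ (X → S)`. [cite: MumfordFogartyKirwan1994, Ch. 1 §3 Def. 1.6 (p. 30)] -/
theorem act_left_comp_hom : (γ[G, X]).left ≫ X.hom = (snd G X).left ≫ X.hom := by
  rw [Over.w, Over.w]; rfl

end Maps

/-! ## §1 The canonical isomorphism `u^* a^* E ≅ E` for a section `u` of `a` -/

section SectionIso

variable {Y Z : Scheme.{u}} {u : Y ⟶ Z} {a : Z ⟶ Y} (h : u ≫ a = 𝟙 Y)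

/-- **`u^* a^* E ≅ E` for `u ≫ a = 𝟙`**: `u^* a^* E ≅ (u ≫ a)^* E = 𝟙^* E ≅ E` (Mathlib `pullbackComp`, `pullbackCongr`, `pullbackId`); plumbing.
[cite: MumfordFogartyKirwan1994, Ch. 1 §3 Def. 1.6 (p. 30)] -/
def sectionPullbackIso (E : Y.Modules) :
    (Scheme.Modules.pullback u).obj ((Scheme.Modules.pullback a).obj E) ≅ E :=
  (Scheme.Modules.pullbackComp u a).app E ≪≫ (Scheme.Modules.pullbackCongr h).app E ≪≫ (Scheme.Modules.pullbackId Y).app E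

/-- Naturality of `sectionPullbackIso` in the module. [cite: MumfordFogartyKirwan1994, Ch. 1 §3 Def. 1.6 (p. 30)] -/
@[reassoc]
theorem sectionPullbackIso_hom_naturality {E F : Y.Modules} (φ : E ⟶ F) :
    (Scheme.Modules.pullback u).map ((Scheme.Modules.pullback a).map φ) ≫ (sectionPullbackIso h F).hom =
      (sectionPullbackIso h E).hom ≫ φ := by
  have h₁ := (Scheme.Modules.pullbackComp u a).hom.naturality φ
  have h₂ := (Scheme.Modules.pullbackCongr h).hom.naturality φ
  have h₃ := (Scheme.Modules.pullbackId Y).hom.naturality φ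
  simp only [Functor.comp_map, Functor.id_map] at h₁ h₂ h₃
  simp only [sectionPullbackIso, Iso.trans_hom, Iso.app_hom, Category.assoc]
  rw [reassoc_of% h₁, reassoc_of% h₂, h₃]

/-- Naturality of `sectionPullbackIso⁻¹` in the module. [cite: MumfordFogartyKirwan1994, Ch. 1 §3 Def. 1.6 (p. 30)] -/
theorem sectionPullbackIso_inv_naturality {E F : Y.Modules} (φ : E ⟶ F) :
    φ ≫ (sectionPullbackIso h F).inv =
      (sectionPullbackIso h E).inv ≫ (Scheme.Modules.pullback u).map ((Scheme.Modules.pullback a).map φ) := by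
  rw [Iso.eq_inv_comp, ← Category.assoc, ← sectionPullbackIso_hom_naturality h φ, Category.assoc, Iso.hom_inv_id,
    Category.comp_id]

end SectionIso

/-! ## §1b The canonical isomorphism `x^* y^* π^* F ≅ ρ^* F` of a composite over the base, and the coherences it satisfies -/

section Coherence

variable {P' P Y S : Scheme.{u}}

/-- **`x^* y^* π^* F ≅ ρ^* F` for `(x ≫ y) ≫ π = ρ`**: `x^* y^* π^* F ≅ (x ≫ y)^* π^* F ≅ ((x ≫ y) ≫ π)^* F = ρ^* F` (Mathlib `pullbackComp` ×2,
`pullbackCongr`); every comparison isomorphism of this file is a composite of these.  [cite: MumfordFogartyKirwan1994, Ch. 1 §3 Def. 1.6 (p. 30)] -/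
def compThreeIso (x : P ⟶ Y) (y : Y ⟶ P') (π : P' ⟶ S) {ρ : P ⟶ S} (H : (x ≫ y) ≫ π = ρ) (F : S.Modules) :
    (Scheme.Modules.pullback x).obj ((Scheme.Modules.pullback y).obj ((Scheme.Modules.pullback π).obj F)) ≅
      (Scheme.Modules.pullback ρ).obj F :=
  (Scheme.Modules.pullbackComp x y).app ((Scheme.Modules.pullback π).obj F) ≪≫ (Scheme.Modules.pullbackComp (x ≫ y) π).app F ≪≫
    (Scheme.Modules.pullbackCongr H).app F

/-- `pullbackCongr` along `k = k'` commutes with `pullbackComp _ π`. [cite: MumfordFogartyKirwan1994, Ch. 1 §3 Def. 1.6 (p. 30)] -/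
@[reassoc]
theorem pullbackCongr_hom_app_comp_pullbackComp_hom_app {k k' : P ⟶ P'} (e : k = k') (π : P' ⟶ S) (F : S.Modules) :
    (Scheme.Modules.pullbackCongr e).hom.app ((Scheme.Modules.pullback π).obj F) ≫ (Scheme.Modules.pullbackComp k' π).hom.app F =
      (Scheme.Modules.pullbackComp k π).hom.app F ≫ (Scheme.Modules.pullbackCongr (show k ≫ π = k' ≫ π by rw [e])).hom.app F := by
  subst e
  simp [Scheme.Modules.pullbackCongr]

/-- `x^*` of `pullbackCongr` along `k = k'` is `x^* k^* ≅ (x ≫ k)^* = (x ≫ k')^* ≅ x^* k'^*`. [cite: MumfordFogartyKirwan1994, Ch. 1 §3 Def. 1.6 (p. 30)] -/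
theorem map_pullbackCongr_hom_app (x : P ⟶ Y) {k k' : Y ⟶ S} (e : k = k') (F : S.Modules) :
    (Scheme.Modules.pullback x).map ((Scheme.Modules.pullbackCongr e).hom.app F) =
      (Scheme.Modules.pullbackComp x k).hom.app F ≫ (Scheme.Modules.pullbackCongr (show x ≫ k = x ≫ k' by rw [e])).hom.app F ≫
        (Scheme.Modules.pullbackComp x k').inv.app F := by
  subst e
  simp [Scheme.Modules.pullbackCongr]
  rfl

/-- Two `pullbackCongr`s compose to the `pullbackCongr` of the composite equality. [cite: MumfordFogartyKirwan1994, Ch. 1 §3 Def. 1.6 (p. 30)] -/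
@[reassoc]
theorem pullbackCongr_hom_app_comp {k₁ k₂ k₃ : P ⟶ S} (h₁ : k₁ = k₂) (h₂ : k₂ = k₃) (F : S.Modules) :
    (Scheme.Modules.pullbackCongr h₁).hom.app F ≫ (Scheme.Modules.pullbackCongr h₂).hom.app F =
      (Scheme.Modules.pullbackCongr (h₁.trans h₂)).hom.app F := by
  subst h₁ h₂
  simp [Scheme.Modules.pullbackCongr]

/-- The inverse of `pullbackCongr h` is `pullbackCongr h.symm`. [cite: MumfordFogartyKirwan1994, Ch. 1 §3 Def. 1.6 (p. 30)] -/
theorem pullbackCongr_inv_app {k₁ k₂ : P ⟶ S} (h : k₁ = k₂) (F : S.Modules) :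
    (Scheme.Modules.pullbackCongr h).inv.app F = (Scheme.Modules.pullbackCongr h.symm).hom.app F := by
  subst h
  simp [Scheme.Modules.pullbackCongr]

/-- **`compThreeIso` through the other bracketing** `x^* y^* π^* F ≅ x^* (y ≫ π)^* F ≅ (x ≫ y ≫ π)^* F = ρ^* F` is the same isomorphism (Mathlib
`pseudofunctor_associativity` via ★ `RelativeSpec.ActionOver.pullbackComp_hom_congr_eq`). [cite: MumfordFogartyKirwan1994, Ch. 1 §3 Def. 1.6 (p. 30)] -/
theorem compThreeIso_eq (x : P ⟶ Y) (y : Y ⟶ P') (π : P' ⟶ S) {ρ : P ⟶ S} (H : (x ≫ y) ≫ π = ρ) (h : x ≫ y ≫ π = ρ) (F : S.Modules) :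
    compThreeIso x y π H F = (Scheme.Modules.pullback x).mapIso ((Scheme.Modules.pullbackComp y π).app F) ≪≫
      (Scheme.Modules.pullbackComp x (y ≫ π)).app F ≪≫ (Scheme.Modules.pullbackCongr h).app F := by
  ext : 1
  have hm := congrArg (fun α => α.app F) (RelativeSpec.ActionOver.pullbackComp_hom_congr_eq (Y := S) x y
    (rfl : x ≫ y = x ≫ y) (rfl : y ≫ π = y ≫ π) h H)
  simp only [NatTrans.comp_app, Functor.whiskerLeft_app, Functor.whiskerRight_app, Functor.associator_inv_app,
    Functor.map_comp] at hm
  erw [Category.id_comp] at hm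
  simp only [compThreeIso, Iso.trans_hom, Iso.app_hom, Functor.mapIso_hom]
  rw [hm]
  simp [Scheme.Modules.pullbackCongr]

/-- **★ `squareIso` of `x ≫ y = x' ≫ y'` at a module `π^* F` pulled back from the base is `compThreeIso x y ≪≫ (compThreeIso x' y')⁻¹`.**
[cite: MumfordFogartyKirwan1994, Ch. 1 §3 Def. 1.6 (p. 30)] -/
theorem squareIso_pullback_obj_eq {x : P ⟶ Y} {y : Y ⟶ P'} {Y' : Scheme.{u}} {x' : P ⟶ Y'} {y' : Y' ⟶ P'} (hsq : x ≫ y = x' ≫ y')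
    (π : P' ⟶ S) {ρ : P ⟶ S} (H : (x ≫ y) ≫ π = ρ) (H' : (x' ≫ y') ≫ π = ρ) (F : S.Modules) :
    RelativeSpec.squareIso hsq ((Scheme.Modules.pullback π).obj F) = compThreeIso x y π H F ≪≫ (compThreeIso x' y' π H' F).symm := by
  ext : 1
  rw [Iso.trans_hom, Iso.symm_hom, Iso.eq_comp_inv]
  simp only [RelativeSpec.squareIso, compThreeIso, Iso.trans_hom, Iso.app_hom, Iso.symm_hom, Iso.app_inv, Category.assoc,
    Iso.inv_hom_id_app_assoc]
  rw [pullbackCongr_hom_app_comp_pullbackComp_hom_app_assoc hsq π F, pullbackCongr_hom_app_comp]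

/-- **`x^*` of the ★ `squareIso` of `a ≫ π = p ≫ π` (at `F`) is `compThreeIso x a ≪≫ (compThreeIso x p)⁻¹`** (`compThreeIso_eq` + naturality of
`pullbackComp x _` along `a ≫ π = p ≫ π`). [cite: MumfordFogartyKirwan1994, Ch. 1 §3 Def. 1.6 (p. 30)] -/
theorem mapIso_squareIso_eq (x : P ⟶ Y) {a p : Y ⟶ P'} {π : P' ⟶ S} (hap : a ≫ π = p ≫ π) {ρ : P ⟶ S}
    (H₁ : (x ≫ a) ≫ π = ρ) (H₂ : (x ≫ p) ≫ π = ρ) (F : S.Modules) :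
    (Scheme.Modules.pullback x).mapIso (RelativeSpec.squareIso hap F) = compThreeIso x a π H₁ F ≪≫ (compThreeIso x p π H₂ F).symm := by
  have h₁ : x ≫ a ≫ π = ρ := by rw [← Category.assoc]; exact H₁
  have h₂ : x ≫ p ≫ π = ρ := by rw [← Category.assoc]; exact H₂
  rw [compThreeIso_eq x a π H₁ h₁ F, compThreeIso_eq x p π H₂ h₂ F]
  ext : 1
  simp only [RelativeSpec.squareIso, Functor.mapIso_hom, Iso.trans_hom, Iso.app_hom, Iso.symm_hom, Iso.app_inv, Iso.trans_inv,
    Functor.mapIso_inv, Functor.map_comp, Category.assoc]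
  rw [map_pullbackCongr_hom_app x hap F, pullbackCongr_inv_app h₂ F]
  simp only [Category.assoc]
  rw [pullbackCongr_hom_app_comp_assoc]

/-- **`sectionPullbackIso` at a module pulled back from the base is a `compThreeIso`** (`u ≫ a = 𝟙`, so `(u ≫ a) ≫ π = π`; Mathlib
`pseudofunctor_right_unitality` through ★ `RelativeSpec.ActionOver.pullbackComp_hom_app_congr_of_eq_id`). [cite: MumfordFogartyKirwan1994, Ch. 1 §3 Def. 1.6 (p. 30)] -/
theorem sectionPullbackIso_pullback_obj_eq {u : Y ⟶ P'} {a : P' ⟶ Y} (h : u ≫ a = 𝟙 Y) (π : Y ⟶ S) (H : (u ≫ a) ≫ π = π) (F : S.Modules) :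
    sectionPullbackIso h ((Scheme.Modules.pullback π).obj F) = compThreeIso u a π H F := by
  ext : 1
  simp only [sectionPullbackIso, compThreeIso, Iso.trans_hom, Iso.app_hom]
  congr 1
  have e' : (u ≫ a) ≫ π = 𝟙 Y ≫ π := by rw [h]
  rw [← pullbackCongr_hom_app_comp e' (Category.id_comp π) F, ← pullbackCongr_hom_app_comp_pullbackComp_hom_app_assoc h π F]
  congr 1
  have h3 := RelativeSpec.ActionOver.pullbackComp_hom_app_congr_of_eq_id (X := Y) (Y := S) (r := π) (f := 𝟙 Y) rfl
    (Category.id_comp π) F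
  rw [h3]
  simp [Scheme.Modules.pullbackCongr]

end Coherence

/-! ## §2 The structure -/

section Structure

variable {S : Scheme.{u}} (G X : Over S) [MonObj G] [σ : ModObj G X]

/-- **A `G`-LINEARISATION (equivariant structure) of the sheaf of modules `E` on `X` for the action `σ = γ[G, X]` of the `S`-group (monoid)
SCHEME `G`** ([MumfordFogartyKirwan1994] Def. 1.6; [SGA3I] Exp. I §4.7): an isomorphism `φ : σ^* E ⥲ p₂^* E` on `G ×_S X` which is the identity along
the unit slice `x ↦ (1, x)` and satisfies the COCYCLE `(μ × 1_X)^* φ = p₂₃^* φ ∘ (1_G × σ)^* φ` on `G ×_S G ×_S X`, each inverse image bracketed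
by the comparison isomorphisms (★ `RelativeSpec.squareIso`) of the squares `σ(μ × 1) = σ(1 × σ)`, `p₂(1 × σ) = σ p₂₃`, `p₂ p₂₃ = p₂(μ × 1)`.  DATA `iso`;
two `Prop`s between named isomorphisms of fixed type.  [cite: MumfordFogartyKirwan1994, Ch. 1 §3 Def. 1.6 (p. 30)] [cite: SGA3I, Exp. I §4.7] -/
structure Linearisation (E : X.left.Modules) where
  /-- `φ : σ^* E ≅ p₂^* E` on `G ×_S X` -/
  iso : (Scheme.Modules.pullback (γ[G, X]).left).obj E ≅ (Scheme.Modules.pullback (snd G X).left).obj E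
  /-- UNIT: `(1, id)^* φ` is the canonical `(1, id)^* σ^* E ≅ E ≅ (1, id)^* p₂^* E` -/
  iso_unit : (Scheme.Modules.pullback (unitSlice G X).left).mapIso iso =
    sectionPullbackIso (unitSlice_act_left G X) E ≪≫ (sectionPullbackIso (unitSlice_snd_left G X) E).symm
  /-- COCYCLE: `(μ × 1)^* φ = can ≫ (1 × σ)^* φ ≫ can ≫ p₂₃^* φ ≫ can` as isomorphisms `(μ × 1)^* σ^* E ≅ (μ × 1)^* p₂^* E` -/
  iso_mul : (Scheme.Modules.pullback (μ[G] ▷ X).left).mapIso iso =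
    RelativeSpec.squareIso (mul_act_left G X) E ≪≫ (Scheme.Modules.pullback (actRight G X).left).mapIso iso ≪≫
      RelativeSpec.squareIso (actRight_snd_left G X) E ≪≫ (Scheme.Modules.pullback (proj₂₃ G X).left).mapIso iso ≪≫
        RelativeSpec.squareIso (proj₂₃_snd_left G X) E

namespace Linearisation

variable {G X} {E E' : X.left.Modules}

/-- The unit condition on morphisms. [cite: MumfordFogartyKirwan1994, Ch. 1 §3 Def. 1.6 (p. 30)] -/
theorem iso_unit_hom (Φ : Linearisation G X E) :
    (Scheme.Modules.pullback (unitSlice G X).left).map Φ.iso.hom =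
      (sectionPullbackIso (unitSlice_act_left G X) E).hom ≫ (sectionPullbackIso (unitSlice_snd_left G X) E).inv := by
  have h := congrArg Iso.hom Φ.iso_unit
  simpa only [Functor.mapIso_hom, Iso.trans_hom, Iso.symm_hom] using h

/-- The cocycle condition on morphisms. [cite: MumfordFogartyKirwan1994, Ch. 1 §3 Def. 1.6 (p. 30)] -/
theorem iso_mul_hom (Φ : Linearisation G X E) :
    (Scheme.Modules.pullback (μ[G] ▷ X).left).map Φ.iso.hom =
      (RelativeSpec.squareIso (mul_act_left G X) E).hom ≫ (Scheme.Modules.pullback (actRight G X).left).map Φ.iso.hom ≫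
        (RelativeSpec.squareIso (actRight_snd_left G X) E).hom ≫ (Scheme.Modules.pullback (proj₂₃ G X).left).map Φ.iso.hom ≫
          (RelativeSpec.squareIso (proj₂₃_snd_left G X) E).hom := by
  have h := congrArg Iso.hom Φ.iso_mul
  simpa only [Functor.mapIso_hom, Iso.trans_hom, Category.assoc] using h

/-! ## §3 Transport along an isomorphism of modules; the canonical linearisation of a module pulled back from the base -/

/-- **Transport of a `G`-linearisation along an isomorphism of modules `e : E ≅ E'`**: `φ' := σ^*(e⁻¹) ≫ φ ≫ p₂^*(e)`.
[cite: MumfordFogartyKirwan1994, Ch. 1 §3 Def. 1.6 (p. 30)] -/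
def ofIso (Φ : Linearisation G X E) (e : E ≅ E') : Linearisation G X E' where
  iso := (Scheme.Modules.pullback (γ[G, X]).left).mapIso e.symm ≪≫ Φ.iso ≪≫ (Scheme.Modules.pullback (snd G X).left).mapIso e
  iso_unit := by
    ext : 1
    simp only [Functor.mapIso_hom, Iso.trans_hom, Iso.symm_hom, Functor.map_comp, Φ.iso_unit_hom, Category.assoc]
    have h₁ := sectionPullbackIso_hom_naturality_assoc (unitSlice_act_left G X) e.inv
      ((sectionPullbackIso (unitSlice_snd_left G X) E).inv ≫
        (Scheme.Modules.pullback (unitSlice G X).left).map ((Scheme.Modules.pullback (snd G X).left).map e.hom))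
    have h₂ := sectionPullbackIso_inv_naturality (unitSlice_snd_left G X) e.hom
    rw [h₁, ← h₂, e.inv_hom_id_assoc]
  iso_mul := by
    ext : 1
    simp only [Functor.mapIso_hom, Iso.trans_hom, Iso.symm_hom, Functor.map_comp, Φ.iso_mul_hom, Category.assoc]
    have hA := RelativeSpec.squareIso_hom_naturality (mul_act_left G X) e.inv
    have hB := RelativeSpec.squareIso_hom_naturality (actRight_snd_left G X) e.hom
    have hC := RelativeSpec.squareIso_hom_naturality (proj₂₃_snd_left G X) e.hom
    have hD : (Scheme.Modules.pullback (proj₂₃ G X).left).map ((Scheme.Modules.pullback (γ[G, X]).left).map e.hom) ≫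
        (Scheme.Modules.pullback (proj₂₃ G X).left).map ((Scheme.Modules.pullback (γ[G, X]).left).map e.inv) = 𝟙 _ := by
      rw [← Functor.map_comp, ← Functor.map_comp, e.hom_inv_id, CategoryTheory.Functor.map_id, CategoryTheory.Functor.map_id]
    rw [reassoc_of% hA, reassoc_of% hB, hC, reassoc_of% hD]

/-- For composable `f : A ⟶ B`, `g : B ⟶ C` in `Over S`: `(f ≫ g) ≫ (C → S) = (A → S)` on underlying schemes. [cite: MumfordFogartyKirwan1994, Ch. 1 §3 Def. 1.6 (p. 30)] -/
theorem comp_left_comp_hom {A B C : Over S} (f : A ⟶ B) (g : B ⟶ C) : (f.left ≫ g.left) ≫ C.hom = A.hom := by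
  rw [Category.assoc, Over.w, Over.w]

variable (G X) in
/-- **THE CANONICAL `G`-LINEARISATION OF A MODULE PULLED BACK FROM THE BASE** (non-vacuity): for `F : S.Modules`, `E := (X → S)^* F` carries
`φ := (σ^* (X → S)^* F ≅ (G ×_S X → S)^* F ≅ p₂^* (X → S)^* F)`; unit and cocycle hold because every isomorphism in them is a composite of
`compThreeIso`s (§1b), which telescope.  The descent datum of every module coming from `S` (effective descent along a torsor `X → S`: all of them).
[cite: MumfordFogartyKirwan1994, Ch. 1 §3 Def. 1.6 (p. 30)] [cite: MumfordAV1970, §12 Thm. 1 (p. 111)] -/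
def ofPullback (F : S.Modules) : Linearisation G X ((Scheme.Modules.pullback X.hom).obj F) where
  iso := RelativeSpec.squareIso (act_left_comp_hom G X) F
  iso_unit := by
    have H₁ : ((unitSlice G X).left ≫ (γ[G, X]).left) ≫ X.hom = X.hom := by rw [unitSlice_act_left, Category.id_comp]
    have H₂ : ((unitSlice G X).left ≫ (snd G X).left) ≫ X.hom = X.hom := by rw [unitSlice_snd_left, Category.id_comp]
    rw [mapIso_squareIso_eq (unitSlice G X).left (act_left_comp_hom G X) H₁ H₂ F,
      sectionPullbackIso_pullback_obj_eq (unitSlice_act_left G X) X.hom H₁ F,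
      sectionPullbackIso_pullback_obj_eq (unitSlice_snd_left G X) X.hom H₂ F]
  iso_mul := by
    rw [mapIso_squareIso_eq (μ[G] ▷ X).left (act_left_comp_hom G X) (comp_left_comp_hom _ _) (comp_left_comp_hom _ _) F,
      mapIso_squareIso_eq (actRight G X).left (act_left_comp_hom G X) (comp_left_comp_hom _ _) (comp_left_comp_hom _ _) F,
      mapIso_squareIso_eq (proj₂₃ G X).left (act_left_comp_hom G X) (comp_left_comp_hom _ _) (comp_left_comp_hom _ _) F,
      squareIso_pullback_obj_eq (mul_act_left G X) X.hom (comp_left_comp_hom _ _) (comp_left_comp_hom _ _) F,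
      squareIso_pullback_obj_eq (actRight_snd_left G X) X.hom (comp_left_comp_hom _ _) (comp_left_comp_hom _ _) F,
      squareIso_pullback_obj_eq (proj₂₃_snd_left G X) X.hom (comp_left_comp_hom _ _) (comp_left_comp_hom _ _) F]
    ext : 1
    simp

end Linearisation

end Structure

/-! ## §4 Restriction of a structure isomorphism along a `G`-morphism (iso level) -/

section Restrict

variable {S : Scheme.{u}} {G X Y : Over S} [MonObj G] [σ : ModObj G X] [τ : ModObj G Y] (f : Y ⟶ X) [IsModHom G f]

/-- A `G`-morphism intertwines the actions: `σ_Y ≫ f = (1_G × f) ≫ σ_X` on underlying schemes (Mathlib `IsModHom.smul_hom`).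
[cite: MumfordFogartyKirwan1994, Ch. 1 §3 Def. 1.6 (p. 30)] -/
theorem act_left_comp_left_of_isModHom : (γ[G, Y]).left ≫ f.left = (G ◁ f).left ≫ (γ[G, X]).left := by
  rw [← Over.comp_left, ← Over.comp_left, IsModHom.smul_hom]
  rfl

omit [MonObj G] σ τ [IsModHom G f] in
/-- `(1_G × f) ≫ p₂ = p₂ ≫ f` on underlying schemes (Mathlib `whiskerLeft_snd`). [cite: MumfordFogartyKirwan1994, Ch. 1 §3 Def. 1.6 (p. 30)] -/
theorem whiskerLeft_left_comp_snd_left : (G ◁ f).left ≫ (snd G X).left = (snd G Y).left ≫ f.left := by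
  rw [← Over.comp_left, ← Over.comp_left, whiskerLeft_snd]

/-- **RESTRICTION OF A STRUCTURE ISOMORPHISM ALONG A `G`-MORPHISM `f : Y ⟶ X`** (iso level): `ψ : σ_X^* E ≅ p₂^* E` on `G ×_S X` gives
`σ_Y^* f^* E ≅ (1 × f)^* σ_X^* E ≅[(1 × f)^* ψ] (1 × f)^* p₂^* E ≅ p₂^* f^* E` on `G ×_S Y` (linearised sheaves pull back along `G`-morphisms); consumers
state NORMALISATIONS with it ([MumfordAV1970] §13: `Λ(L)` restricted along the stable slice `{0} × X` is trivially linearised).  Plumbing only.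
[cite: MumfordFogartyKirwan1994, Ch. 1 §3 Def. 1.6 (p. 30)] [cite: MumfordAV1970, §13 Theorem (p. 125) and its proof (pp. 125–127)] -/
def restrictIso (E : X.left.Modules)
    (ψ : (Scheme.Modules.pullback (γ[G, X]).left).obj E ≅ (Scheme.Modules.pullback (snd G X).left).obj E) :
    (Scheme.Modules.pullback (γ[G, Y]).left).obj ((Scheme.Modules.pullback f.left).obj E) ≅
      (Scheme.Modules.pullback (snd G Y).left).obj ((Scheme.Modules.pullback f.left).obj E) :=
  RelativeSpec.squareIso (act_left_comp_left_of_isModHom f) E ≪≫ (Scheme.Modules.pullback (G ◁ f).left).mapIso ψ ≪≫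
    RelativeSpec.squareIso (whiskerLeft_left_comp_snd_left f) E

end Restrict

end Literature.AlgebraicGeometry.Modules
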